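import Mathlib
import HarnessLib
import Summits.MatrixMultiplication.MatrixMultiplication.Theorems.OutsiderSandwichFaceCertificates

/-!
# OutsiderSandwich — PRODUCT LOCALISATION in a Strassen preorder: exchange rates, the max-ratio
formula, and the multiplier-free normal form of «a face meets the top fibre»
(decomp-mm lens 4 «minimal counterexample / extremal reduction», gen 36, part 1/2: abstract theory)

Route `route-MatrixMultiplication-OutsiderSandwich`; cut of record UNCHANGED
(`closes (h₁ : LaserTangency) (h₂ : LaserMergeOptimal) (h₃ : SummitIffLaserTangency) : ω(ℂ) = 2`,
`LaserMergeOptimal` = stmt-27897 the declared residual).  Theorem-only, definition-free support;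
continues g35 (`OutsiderSandwichFaceLocalisation`, `OutsiderSandwichFaceCertificates`).

THE SETTING.  `≼` a Strassen preorder on a commutative semiring `S`, `X` its asymptotic spectrum
(compact, Zuiddam Thm. 2.15), `u ≼~ v` (`AsympLe`) valid iff `φ(u) ≤ φ(v)` on `X` (Zuiddam Thm. 2.12).
An **exchange** for the pair `(x, y)` is a valid inequality `q·x ≼~ p·y` with `p, q ∈ ℕ`; its **rate**
is `p/q`.

§1 **EXCHANGE RATES = MAX RATIO** (`exchange_iff_forall`, `exists_isMaxOn_ratio`, `isGLB_ratioMax`,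
   `ratioMax_eq_sInf`): if `φ(y) > 0` on `X`, the ratio `φ(x)/φ(y)` attains its maximum `r*` on `X` and

        `r* = max_X φ(x)/φ(y) = inf { p/q : q ≥ 1, q·x ≼~ p·y }`

   (Strassen duality for the RELATIVE rank of `x` over `y`; `y = 1` is Zuiddam Cor. 2.13).  The
   ATTAINMENT CRITERION (`attains_iff_exchange`, `lt_iff_cheapExchange`): for an upper bound `C` of
   the ratio,  `(∃ φ ∈ X, φ(x) = C·φ(y)) ⟺ ∀ p q, (q·x ≼~ p·y) → C·q ≤ p`,  and the bound is STRICT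
   everywhere iff some exchange is CHEAP: `p < C·q`.

§2 **PRODUCT LOCALISATION** (`faceLevel_iff_productExchange`, `face_meets_top_iff_productExchange`,
   `face_meets_top_iff_powExchange`, `face_misses_top_iff_cheapProductExchange`).  For a valid
   `u ≼~ v` with `φ(u) > 0` on `X` and `1 ≼ a`, the face `Z(u,v) = {φ(u) = φ(v)}` MEETS the top fibre
   `{φ(a) = R̃(a)}` iff exchanging the PRODUCT `a·u` against `v` is never cheaper than buying `a`:

        `(∃ φ ∈ X, φ(u) = φ(v) ∧ φ(a) = R̃(a)) ⟺ ∀ p q, (q·(a·u) ≼~ p·v) → (q·a ≼~ p)`,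

   because `φ(a)·φ(u) ≤ R̃(a)·φ(v)` with equality iff BOTH `φ(a) = R̃(a)` and `φ(u) = φ(v)` (the two
   defects multiply instead of adding).  Compared with the additive certificates `q·a + n·u ≼~ p + n·v`
   of g35 (`face_meets_top_iff_noSubsidy`) the product form has NO multiplier `n` and no additive
   constant: a two-parameter, catalyst-free normal form.  Part 2 (`OutsiderSandwichExchange`) reads the
   route's residual `LaserMergeOptimal` this way with `a = [⟨2,2,2⟩]`, `u = 27·a`, `v = 4·[cw₂]³`
   (and, via §1, with the single pair `x = [⟨2,2,2⟩]`, `y = [cw₂]`).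

Nearest prior art (searched g36 — corpus fts+vec: "Vergleichsstellensatz", "preordered semiring asymptotic
rate", "resource convertibility ordered commutative monoids rate"; galaxy: "Vergleichsstellensatz",
"preordered semiring"): §1 is the instance, for the additive monoid `(S, +, ≼~)` with the spectral
points as functionals, of Fritz's RATE FORMULA `R_max(y → x) = inf_f f(y)/f(x)` (T. Fritz, *The
mathematical structure of theories of resource convertibility I*, Math. Struct. Comput. Sci. 27 (2017),
arXiv:1504.03661, Thm. 8.24, §8) combined with Zuiddam Thm. 2.12 / Thm. 2.15 (the case `y = 1` is Zuiddam Cor. 2.13 /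
Strassen 1988 Thm. 3.8); Vrana, *A generalization of Strassen's theorem on preordered semirings*, Order
(2021), doi:10.1007/s11083-021-09570-7, §1 («rate formulas»).  Delta: §2 — MULTIPLICATIVITY of spectral
points multiplies the two defects `R̃(a) − φ(a)` and `φ(v) − φ(u)`, which removes the catalyst/multiplier
from face-vs-top-fibre localisation (outside the ordered-monoid framework of the rate formula).
References: [cite: Zuiddam2018, Def. 2.1, Thm. 2.12, Cor. 2.13, Thm. 2.15]; [cite: Strassen1988, Thm. 2.4,
Thm. 3.8]; Fritz 2017, arXiv:1504.03661, Thm. 8.24; Vrana 2021, doi:10.1007/s11083-021-09570-7.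
-/

set_option linter.dupNamespace false

namespace Summit.MatrixMultiplication.MatrixMultiplication.Theorems.OutsiderSandwichProductLocalisation

open Literature.Computability.AlgebraicComplexity
open Summit.MatrixMultiplication.MatrixMultiplication.Theorems.OutsiderSandwichFaceLocalisation
open Summit.MatrixMultiplication.MatrixMultiplication.Theorems.OutsiderSandwichFaceCertificates

universe u

variable {S : Type u} [CommSemiring S] {le : S → S → Prop}

/-! ## §1  Exchange rates and the max-ratio formula -/

/-- **Soundness/completeness of an exchange**: `q·x ≼~ p·y ⟺ q·φ(x) ≤ p·φ(y)` on `X`.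
[cite: Zuiddam2018, Thm. 2.12] -/
theorem exchange_iff_forall (h : IsStrassenPreorder le) (x y : S) (p q : ℕ) :
    AsympLe le ((q : S) * x) ((p : S) * y) ↔
    ∀ φ, IsSpectralPoint le φ → (q : ℝ) * φ x ≤ p * φ y := by
  rw [h.asympLe_iff_forall_spectralPoint]
  constructor
  · intro H φ hφ
    have h1 := H φ hφ
    rwa [hφ.map_mul, hφ.map_mul, hφ.map_natCast, hφ.map_natCast] at h1
  · intro H φ hφ
    rw [hφ.map_mul, hφ.map_mul, hφ.map_natCast, hφ.map_natCast]
    exact H φ hφ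

/-- `1 ≼ y` makes `φ(y) ≥ 1 > 0` on `X`. [cite: Zuiddam2018, Def. 2.8] -/
theorem spectralPoint_pos_of_one_le {y : S} (hy : le 1 y) :
    ∀ φ, IsSpectralPoint le φ → 0 < φ y := fun φ hφ =>
  lt_of_lt_of_le one_pos (by simpa [hφ.map_one] using hφ.mono hy)

/-- `1 ≼ y` makes `X` nonempty (a point with `φ(y) = R̃(y)` exists). [cite: Zuiddam2018, Cor. 2.13] -/
theorem spectrum_nonempty_of_one_le (h : IsStrassenPreorder le) {y : S} (hy : le 1 y) :
    ∃ φ : S → ℝ, IsSpectralPoint le φ := by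
  obtain ⟨φ, hφ, -⟩ := h.exists_isSpectralPoint_eq_asympRankOf y hy
  exact ⟨φ, hφ⟩

/-- **The ratio `φ(x)/φ(y)` attains its maximum on the spectrum** (compactness, `φ(y) > 0`).
[cite: Zuiddam2018, Thm. 2.15] -/
theorem exists_isMaxOn_ratio (h : IsStrassenPreorder le) (x : S) {y : S}
    (hX : ∃ φ : S → ℝ, IsSpectralPoint le φ) (hy : ∀ φ, IsSpectralPoint le φ → 0 < φ y) :
    ∃ φ₀ : S → ℝ, IsSpectralPoint le φ₀ ∧
      ∀ ψ, IsSpectralPoint le ψ → ψ x / ψ y ≤ φ₀ x / φ₀ y := by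
  have hcont : ContinuousOn (fun φ : S → ℝ => φ x / φ y) {φ : S → ℝ | IsSpectralPoint le φ} :=
    (continuous_apply x).continuousOn.div (continuous_apply y).continuousOn
      (fun φ hφ => (hy φ hφ).ne')
  obtain ⟨φ₁, hφ₁⟩ := hX
  obtain ⟨φ₀, hφ₀, hmax⟩ :=
    h.isCompact_setOf_isSpectralPoint.exists_isMaxOn ⟨φ₁, hφ₁⟩ hcont
  exact ⟨φ₀, hφ₀, fun ψ hψ => hmax hψ⟩

/-- **MAX RATIO = INFIMUM OF EXCHANGE RATES (relative Strassen duality).**  If `φ(y) > 0` on `X` and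
`φ₀ ∈ X` maximises `φ(x)/φ(y)`, then `φ₀(x)/φ₀(y)` is the greatest lower bound of the exchange rates
`{p/q : q ≥ 1, q·x ≼~ p·y}` (Fritz's rate formula, arXiv:1504.03661 Thm. 8.24, in `(S, +, ≼~)`).
[cite: Zuiddam2018, Thm. 2.12, Cor. 2.13, Thm. 2.15; Strassen1988, Thm. 3.8] -/
theorem isGLB_ratioMax (h : IsStrassenPreorder le) {x y : S}
    (hy : ∀ φ, IsSpectralPoint le φ → 0 < φ y) {φ₀ : S → ℝ} (hφ₀ : IsSpectralPoint le φ₀)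
    (hmax : ∀ ψ, IsSpectralPoint le ψ → ψ x / ψ y ≤ φ₀ x / φ₀ y) :
    IsGLB {t : ℝ | ∃ p q : ℕ, 0 < q ∧ t = (p : ℝ) / q ∧ AsympLe le ((q : S) * x) ((p : S) * y)}
      (φ₀ x / φ₀ y) := by
  have hy0 : 0 < φ₀ y := hy φ₀ hφ₀
  set M := φ₀ x / φ₀ y with hM
  have hM0 : 0 ≤ M := div_nonneg (hφ₀.nonneg h x) hy0.le
  have hMub : ∀ ψ, IsSpectralPoint le ψ → ψ x ≤ M * ψ y := fun ψ hψ => by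
    have := hmax ψ hψ
    rwa [div_le_iff₀ (hy ψ hψ)] at this
  constructor
  · rintro t ⟨p, q, hq, rfl, hc⟩
    have h1 := (exchange_iff_forall h x y p q).1 hc φ₀ hφ₀
    have hq' : (0 : ℝ) < q := Nat.cast_pos.2 hq
    rw [hM, div_le_div_iff₀ hy0 hq']
    linarith [mul_comm (q : ℝ) (φ₀ x)]
  · intro t ht
    by_contra hlt
    push Not at hlt
    -- a rational `p/q` with `M < p/q < t`
    obtain ⟨q, hq⟩ := exists_nat_gt (2 / (t - M))
    have hq0 : (0 : ℝ) < q := lt_trans (div_pos two_pos (sub_pos.2 hlt)) hq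
    have hqt : 2 < (q : ℝ) * (t - M) := (div_lt_iff₀ (sub_pos.2 hlt)).1 hq
    obtain ⟨p, hp1, hp2⟩ : ∃ p : ℕ, (q : ℝ) * M < p ∧ (p : ℝ) ≤ q * M + 1 := by
      refine ⟨⌊(q : ℝ) * M⌋₊ + 1, ?_, ?_⟩
      · push_cast
        exact Nat.lt_floor_add_one _
      · push_cast
        linarith [Nat.floor_le (mul_nonneg hq0.le hM0)]
    have hc : AsympLe le ((q : S) * x) ((p : S) * y) := by
      refine (exchange_iff_forall h x y p q).2 fun ψ hψ => ?_
      have h1 : (q : ℝ) * ψ x ≤ q * (M * ψ y) := mul_le_mul_of_nonneg_left (hMub ψ hψ) hq0.le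
      nlinarith [(hy ψ hψ).le]
    have hmem : (p : ℝ) / q ∈ {t : ℝ | ∃ p q : ℕ, 0 < q ∧ t = (p : ℝ) / q ∧
        AsympLe le ((q : S) * x) ((p : S) * y)} := ⟨p, q, by exact_mod_cast hq0, rfl, hc⟩
    have h2 := ht hmem
    have h4 : (p : ℝ) / q < t := by
      rw [div_lt_iff₀ hq0]
      linarith [mul_sub (q : ℝ) t M, mul_comm t (q : ℝ)]
    linarith

/-- **The max ratio as an infimum**: `max_X φ(x)/φ(y) = inf {p/q : q ≥ 1, q·x ≼~ p·y}`.
[cite: Zuiddam2018, Thm. 2.12, Cor. 2.13, Thm. 2.15] -/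
theorem ratioMax_eq_sInf (h : IsStrassenPreorder le) {x y : S}
    (hy : ∀ φ, IsSpectralPoint le φ → 0 < φ y) {φ₀ : S → ℝ} (hφ₀ : IsSpectralPoint le φ₀)
    (hmax : ∀ ψ, IsSpectralPoint le ψ → ψ x / ψ y ≤ φ₀ x / φ₀ y) :
    φ₀ x / φ₀ y =
      sInf {t : ℝ | ∃ p q : ℕ, 0 < q ∧ t = (p : ℝ) / q ∧ AsympLe le ((q : S) * x) ((p : S) * y)} := by
  -- the set is nonempty: `y ≠ 0`, so `x ≼ r·y` for some `r` (strong Archimedean axiom)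
  have hy_ne : y ≠ 0 := fun h0 => (hy φ₀ hφ₀).ne' (by rw [h0, hφ₀.map_zero])
  obtain ⟨r, hr⟩ := h.exists_le_natCast_mul x hy_ne
  refine ((isGLB_ratioMax h hy hφ₀ hmax).csInf_eq ⟨(r : ℝ) / ((1 : ℕ) : ℝ), ?_⟩).symm
  refine ⟨r, 1, one_pos, rfl, (exchange_iff_forall h x y r 1).2 fun ψ hψ => ?_⟩
  have h1 := hψ.mono hr
  rw [hψ.map_mul, hψ.map_natCast] at h1
  simpa using h1

/-- **ATTAINMENT CRITERION.**  If `C` bounds the ratio (`φ(x) ≤ C·φ(y)` on `X`, `φ(y) > 0`, `X ≠ ∅`),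
then the bound is ATTAINED iff no exchange beats the rate `C`:
`(∃ φ ∈ X, φ(x) = C·φ(y)) ⟺ ∀ p q, (q·x ≼~ p·y) → C·q ≤ p`.
(⟹: evaluate the exchange at the attaining point; ⟸: otherwise `C·φ(y) − φ(x) ≥ δ > 0` on the compact
`X`, so `φ(x) ≤ (C − δ/R(y))·φ(y)` and a rational rate in `[C − δ/R(y), C)` is a cheap exchange.)
[cite: Zuiddam2018, Thm. 2.12, Thm. 2.15] -/
theorem attains_iff_exchange (h : IsStrassenPreorder le) {x y : S} {C : ℝ}
    (hX : ∃ φ : S → ℝ, IsSpectralPoint le φ) (hy : ∀ φ, IsSpectralPoint le φ → 0 < φ y)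
    (hC : ∀ φ, IsSpectralPoint le φ → φ x ≤ C * φ y) :
    (∃ φ : S → ℝ, IsSpectralPoint le φ ∧ φ x = C * φ y) ↔
    ∀ p q : ℕ, AsympLe le ((q : S) * x) ((p : S) * y) → C * q ≤ p := by
  constructor
  · rintro ⟨φ, hφ, hφe⟩ p q hc
    have h1 := (exchange_iff_forall h x y p q).1 hc φ hφ
    rw [hφe] at h1
    have h2 : C * q * φ y ≤ p * φ y := by linarith [mul_assoc (q : ℝ) C (φ y), mul_comm (q : ℝ) C]
    exact le_of_mul_le_mul_right h2 (hy φ hφ)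
  · intro H
    by_contra hno
    push Not at hno
    have hlt : ∀ φ, IsSpectralPoint le φ → φ x < C * φ y := fun φ hφ =>
      lt_of_le_of_ne (hC φ hφ) (hno φ hφ)
    -- the defect `C φ(y) - φ(x)` is positive on the compact nonempty `X`: minimum `δ > 0`
    obtain ⟨φ₁, hφ₁⟩ := hX
    obtain ⟨φ₀, hφ₀, hmin⟩ := h.isCompact_setOf_isSpectralPoint.exists_isMinOn ⟨φ₁, hφ₁⟩
      ((continuous_const.mul (continuous_apply y)).sub (continuous_apply x)).continuousOn
    set δ := C * φ₀ y - φ₀ x with hδ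
    have hδ0 : 0 < δ := sub_pos.2 (hlt φ₀ hφ₀)
    have hy0 : 0 < φ₀ y := hy φ₀ hφ₀
    have hx0 : 0 ≤ φ₀ x := hφ₀.nonneg h x
    have hC0 : 0 < C := by
      by_contra hC0
      push Not at hC0
      nlinarith [hlt φ₀ hφ₀]
    -- `Y = R(y) ≥ φ(y)`, `Y > 0`; `η = δ / Y`
    set Y : ℝ := (rankOf le y : ℝ) with hY
    have hYge : ∀ φ, IsSpectralPoint le φ → φ y ≤ Y := fun φ hφ => hφ.le_rankOf h y
    have hY0 : 0 < Y := lt_of_lt_of_le hy0 (hYge φ₀ hφ₀)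
    set η := δ / Y with hη
    have hη0 : 0 < η := div_pos hδ0 hY0
    have hηC : η ≤ C := by
      rw [hη, div_le_iff₀ hY0]
      have : δ ≤ C * φ₀ y := by linarith
      nlinarith [hYge φ₀ hφ₀]
    have hbound : ∀ φ, IsSpectralPoint le φ → φ x ≤ (C - η) * φ y := by
      intro φ hφ
      have h1 : δ ≤ C * φ y - φ x := hmin (show φ ∈ {φ : S → ℝ | IsSpectralPoint le φ} from hφ)
      have h2 : η * φ y ≤ δ := by
        rw [hη, div_mul_eq_mul_div, div_le_iff₀ hY0]
        exact mul_le_mul_of_nonneg_left (hYge φ hφ) hδ0.le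
      nlinarith
    -- choose `q` with `q η > 1` and `p = ⌈q (C - η)⌉`: then `q (C - η) ≤ p < q C`
    obtain ⟨q, hq⟩ := exists_nat_gt (1 / η)
    have hq0 : (0 : ℝ) < q := lt_trans (by positivity) hq
    have hqη : 1 < (q : ℝ) * η := by
      have := (div_lt_iff₀ hη0).1 hq
      linarith
    have hnn : 0 ≤ (q : ℝ) * (C - η) := mul_nonneg hq0.le (sub_nonneg.2 hηC)
    set p : ℕ := ⌈(q : ℝ) * (C - η)⌉₊ with hp
    have hp1 : (q : ℝ) * (C - η) ≤ p := Nat.le_ceil _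
    have hp2 : (p : ℝ) < q * (C - η) + 1 := Nat.ceil_lt_add_one hnn
    have hc : AsympLe le ((q : S) * x) ((p : S) * y) := by
      refine (exchange_iff_forall h x y p q).2 fun φ hφ => ?_
      have h1 : (q : ℝ) * φ x ≤ q * ((C - η) * φ y) := mul_le_mul_of_nonneg_left (hbound φ hφ) hq0.le
      nlinarith [(hy φ hφ).le]
    have h3 := H p q hc
    nlinarith

/-- **STRICT EVERYWHERE ⟺ A CHEAP EXCHANGE EXISTS**: under the hypotheses of `attains_iff_exchange`,
`(∀ φ ∈ X, φ(x) < C·φ(y)) ⟺ ∃ p q, p < C·q ∧ q·x ≼~ p·y`. [cite: Zuiddam2018, Thm. 2.12, Thm. 2.15] -/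
theorem lt_iff_cheapExchange (h : IsStrassenPreorder le) {x y : S} {C : ℝ}
    (hX : ∃ φ : S → ℝ, IsSpectralPoint le φ) (hy : ∀ φ, IsSpectralPoint le φ → 0 < φ y)
    (hC : ∀ φ, IsSpectralPoint le φ → φ x ≤ C * φ y) :
    (∀ φ : S → ℝ, IsSpectralPoint le φ → φ x < C * φ y) ↔
    ∃ p q : ℕ, (p : ℝ) < C * q ∧ AsympLe le ((q : S) * x) ((p : S) * y) := by
  have key := attains_iff_exchange h hX hy hC
  constructor
  · intro H
    have hno : ¬ ∃ φ : S → ℝ, IsSpectralPoint le φ ∧ φ x = C * φ y := by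
      rintro ⟨φ, hφ, hφe⟩
      exact absurd hφe (H φ hφ).ne
    rw [key] at hno
    push Not at hno
    obtain ⟨p, q, hc, hlt⟩ := hno
    exact ⟨p, q, hlt, hc⟩
  · rintro ⟨p, q, hpq, hc⟩ φ hφ
    refine lt_of_le_of_ne (hC φ hφ) fun hφe => ?_
    have h1 := key.1 ⟨φ, hφ, hφe⟩ p q hc
    linarith

/-! ## §2  Product localisation: the face of `u ≼~ v` against the top fibre of `a` -/

/-- **Two defects multiply**: for reals `α ≤ A`, `0 < β ≤ B`, `0 < A`:
`α·β = A·B ⟺ α = A ∧ β = B`. -/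
theorem mul_eq_mul_iff_eq_and_eq {α β A B : ℝ} (hαA : α ≤ A) (hβ0 : 0 < β)
    (hβB : β ≤ B) (hA0 : 0 < A) : α * β = A * B ↔ α = A ∧ β = B := by
  constructor
  · intro he
    have h1 : α * β ≤ A * β := mul_le_mul_of_nonneg_right hαA hβ0.le
    have h2 : A * β ≤ A * B := mul_le_mul_of_nonneg_left hβB hA0.le
    have e1 : A * β = A * B := le_antisymm h2 (he ▸ h1)
    have hβ : β = B := mul_left_cancel₀ hA0.ne' e1
    refine ⟨?_, hβ⟩
    have e2 : α * β = A * β := by rw [he, e1]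
    exact mul_right_cancel₀ hβ0.ne' e2
  · rintro ⟨rfl, rfl⟩
    rfl

/-- **PRODUCT LOCALISATION, abstract level form.**  Let `u ≼~ v` be valid with `φ(u) > 0` on `X`,
`X ≠ ∅`, and let `x` have the upper level `T > 0` (`φ(x) ≤ T` on `X`).  Then the face `Z(u,v)` meets
the level set `{φ(x) = T}` iff no product exchange beats the rate `T`:
`(∃ φ ∈ X, φ(u) = φ(v) ∧ φ(x) = T) ⟺ ∀ p q, (q·(x·u) ≼~ p·v) → q·T ≤ p`.
[cite: Zuiddam2018, Thm. 2.12, Thm. 2.15] -/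
theorem faceLevel_iff_productExchange (h : IsStrassenPreorder le) {u v x : S} {T : ℝ}
    (hval : ∀ φ, IsSpectralPoint le φ → φ u ≤ φ v) (hu : ∀ φ, IsSpectralPoint le φ → 0 < φ u)
    (hX : ∃ φ : S → ℝ, IsSpectralPoint le φ) (hT : 0 < T)
    (hxT : ∀ φ, IsSpectralPoint le φ → φ x ≤ T) :
    (∃ φ : S → ℝ, IsSpectralPoint le φ ∧ φ u = φ v ∧ φ x = T) ↔
    ∀ p q : ℕ, AsympLe le ((q : S) * (x * u)) ((p : S) * v) → (q : ℝ) * T ≤ p := by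
  have hv : ∀ φ, IsSpectralPoint le φ → 0 < φ v := fun φ hφ => lt_of_lt_of_le (hu φ hφ) (hval φ hφ)
  have hC : ∀ φ, IsSpectralPoint le φ → φ (x * u) ≤ T * φ v := fun φ hφ => by
    rw [hφ.map_mul]
    calc φ x * φ u ≤ T * φ u := mul_le_mul_of_nonneg_right (hxT φ hφ) (hu φ hφ).le
      _ ≤ T * φ v := mul_le_mul_of_nonneg_left (hval φ hφ) hT.le
  have key := attains_iff_exchange h (x := x * u) (y := v) (C := T) hX hv hC
  have hpt : ∀ φ, IsSpectralPoint le φ → (φ (x * u) = T * φ v ↔ φ u = φ v ∧ φ x = T) := by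
    intro φ hφ
    rw [hφ.map_mul, mul_eq_mul_iff_eq_and_eq (hxT φ hφ) (hu φ hφ) (hval φ hφ) hT]
    exact and_comm
  constructor
  · rintro ⟨φ, hφ, hφf, hφx⟩ p q hc
    have h1 := key.1 ⟨φ, hφ, (hpt φ hφ).2 ⟨hφf, hφx⟩⟩ p q hc
    linarith [mul_comm T (q : ℝ)]
  · intro H
    obtain ⟨φ, hφ, hφe⟩ := key.2 fun p q hc => by
      have := H p q hc; linarith [mul_comm T (q : ℝ)]
    exact ⟨φ, hφ, (hpt φ hφ).1 hφe⟩

/-- `1 ≼ a` gives `R̃(a) ≥ 1 > 0`. [cite: Zuiddam2018, Cor. 2.13] -/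
theorem asympRankOf_pos_of_one_le (h : IsStrassenPreorder le) {a : S} (ha : le 1 a) :
    0 < asympRankOf le a := by
  obtain ⟨φ, hφ, hφa⟩ := h.exists_isSpectralPoint_eq_asympRankOf a ha
  rw [← hφa]
  exact spectralPoint_pos_of_one_le ha φ hφ

/-- **PRODUCT LOCALISATION: the face meets the top fibre iff product exchanges never undercut `a`.**
For a valid `u ≼~ v` with `φ(u) > 0` on `X` and `1 ≼ a`:
`(∃ φ ∈ X, φ(u) = φ(v) ∧ φ(a) = R̃(a)) ⟺ ∀ p q, (q·(a·u) ≼~ p·v) → (q·a ≼~ p)`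
— no multiplier and no additive constant (contrast `face_meets_top_iff_noSubsidy`).
[cite: Zuiddam2018, Thm. 2.12, Cor. 2.13, Thm. 2.15] -/
theorem face_meets_top_iff_productExchange (h : IsStrassenPreorder le) {u v a : S}
    (hval : ∀ φ, IsSpectralPoint le φ → φ u ≤ φ v) (hu : ∀ φ, IsSpectralPoint le φ → 0 < φ u)
    (ha : le 1 a) :
    (∃ φ : S → ℝ, IsSpectralPoint le φ ∧ φ u = φ v ∧ φ a = asympRankOf le a) ↔
    ∀ p q : ℕ, AsympLe le ((q : S) * (a * u)) ((p : S) * v) → AsympLe le ((q : S) * a) (p : S) := by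
  rw [faceLevel_iff_productExchange h hval hu (spectrum_nonempty_of_one_le h ha)
    (asympRankOf_pos_of_one_le h ha) (fun φ hφ => hφ.le_asympRankOf h a)]
  simp only [asympLe_natMul_natCast_iff h ha]

/-- **Power version** (`k ≥ 1` copies of `a` in the product; `φ(a)^k = R̃(a)^k ⟺ φ(a) = R̃(a)`):
`(∃ φ ∈ X, φ(u) = φ(v) ∧ φ(a) = R̃(a)) ⟺ ∀ p q, (q·(a^k·u) ≼~ p·v) → q·R̃(a)^k ≤ p`.
[cite: Zuiddam2018, Thm. 2.12, Cor. 2.13, Thm. 2.15] -/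
theorem face_meets_top_iff_powExchange (h : IsStrassenPreorder le) {u v a : S}
    (hval : ∀ φ, IsSpectralPoint le φ → φ u ≤ φ v) (hu : ∀ φ, IsSpectralPoint le φ → 0 < φ u)
    (ha : le 1 a) {k : ℕ} (hk : k ≠ 0) :
    (∃ φ : S → ℝ, IsSpectralPoint le φ ∧ φ u = φ v ∧ φ a = asympRankOf le a) ↔
    ∀ p q : ℕ, AsympLe le ((q : S) * (a ^ k * u)) ((p : S) * v) →
      (q : ℝ) * asympRankOf le a ^ k ≤ p := by
  have hA0 := asympRankOf_pos_of_one_le h ha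
  rw [← faceLevel_iff_productExchange h hval hu (spectrum_nonempty_of_one_le h ha) (pow_pos hA0 k)
    (fun φ hφ => by
      rw [hφ.map_pow]
      exact pow_le_pow_left₀ (hφ.nonneg h a) (hφ.le_asympRankOf h a) k)]
  refine exists_congr fun φ => and_congr_right fun hφ => and_congr_right fun _ => ?_
  rw [hφ.map_pow, pow_left_inj₀ (hφ.nonneg h a) hA0.le hk]

/-- **The face MISSES the top fibre iff some product exchange is CHEAP** (`p < q·R̃(a)`):
`(∀ φ ∈ Z(u,v), φ(a) < R̃(a)) ⟺ ∃ p q, p < q·R̃(a) ∧ q·(a·u) ≼~ p·v`.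
[cite: Zuiddam2018, Thm. 2.12, Cor. 2.13, Thm. 2.15] -/
theorem face_misses_top_iff_cheapProductExchange (h : IsStrassenPreorder le) {u v a : S}
    (hval : ∀ φ, IsSpectralPoint le φ → φ u ≤ φ v) (hu : ∀ φ, IsSpectralPoint le φ → 0 < φ u)
    (ha : le 1 a) :
    (∀ φ : S → ℝ, IsSpectralPoint le φ → φ u = φ v → φ a < asympRankOf le a) ↔
    ∃ p q : ℕ, (p : ℝ) < q * asympRankOf le a ∧ AsympLe le ((q : S) * (a * u)) ((p : S) * v) := by
  have key := faceLevel_iff_productExchange h hval hu (spectrum_nonempty_of_one_le h ha)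
    (asympRankOf_pos_of_one_le h ha) (fun φ hφ => hφ.le_asympRankOf h a)
  constructor
  · intro H
    have hno : ¬ ∃ φ : S → ℝ, IsSpectralPoint le φ ∧ φ u = φ v ∧ φ a = asympRankOf le a := by
      rintro ⟨φ, hφ, hφf, hφa⟩
      exact absurd hφa (H φ hφ hφf).ne
    rw [key] at hno
    push Not at hno
    obtain ⟨p, q, hc, hlt⟩ := hno
    exact ⟨p, q, hlt, hc⟩
  · rintro ⟨p, q, hpq, hc⟩ φ hφ hφf
    refine lt_of_le_of_ne (hφ.le_asympRankOf h a) fun hφa => ?_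
    have h1 := key.1 ⟨φ, hφ, hφf, hφa⟩ p q hc
    linarith

/-- **Each product exchange is an instrument on the top fibre price**: if the face meets the top fibre,
every `q·(a·u) ≼~ p·v` certifies `q·R̃(a) ≤ p`. [cite: Zuiddam2018, Thm. 2.12, Cor. 2.13] -/
theorem asympRankOf_le_of_productExchange (h : IsStrassenPreorder le) {u v a : S}
    (hu : ∀ φ, IsSpectralPoint le φ → 0 < φ u)
    (hmeet : ∃ φ : S → ℝ, IsSpectralPoint le φ ∧ φ u = φ v ∧ φ a = asympRankOf le a)
    {p q : ℕ} (hc : AsympLe le ((q : S) * (a * u)) ((p : S) * v)) :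
    (q : ℝ) * asympRankOf le a ≤ p := by
  obtain ⟨φ, hφ, hφf, hφa⟩ := hmeet
  have hv0 : 0 < φ v := by rw [← hφf]; exact hu φ hφ
  have h1 := (h.asympLe_iff_forall_spectralPoint.1 hc) φ hφ
  simp only [hφ.map_mul, hφ.map_natCast] at h1
  rw [hφf, hφa] at h1
  have h2 : (q : ℝ) * asympRankOf le a * φ v ≤ p * φ v := by
    linarith [mul_assoc (q : ℝ) (asympRankOf le a) (φ v)]
  exact le_of_mul_le_mul_right h2 hv0

end Summit.MatrixMultiplication.MatrixMultiplication.Theorems.OutsiderSandwichProductLocalisation
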